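import Mathlib
import Literature.MathematicalPhysics.QuantumFieldTheory.Balaban1983to89.MatrixLog
import Literature.MathematicalPhysics.QuantumFieldTheory.Balaban1983to89.B7BlockAvgLog

/-!
# `Federbush1986.PureAveragesUNGauss` — P. Federbush, *A phase cell approach to Yang–Mills theory. III. Local stability,
# modified renormalization group transformation*, Commun. Math. Phys. **110** (1987) 293–309 [Federbush1987PhaseCellIII],
# §1 «Pure Averages of Group Elements» p. 294–295, MODEL INSTANCE `G = U(N)` (every `N`), part 1 of 2: the matrix analysis
# behind Lemma 1.0 (1.3) for the bi-invariant Frobenius length metric — a discrete Gauss lemma for `log(e^X e^Z)`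

statement-level skeleton of published theorems with citation tags; proofs where landed; nothing here is a claim about the Yang–Mills mass gap

PDF held: `fed1987-cmp110-III` (scan `run/shared/lean/pub/pub-balaban/t4/b2b-balaban-t4-lit2/pdf/fed1987-cmp110-III.pdf`, renders
`run/shared/lean/pub/lit-balaban/lit-balaban-r17/renders/fedIII/fed1987-cmp110-III-p003-x2.png` (p. 295); journal page = PDF
page + 292), read as images; J. M. Lee, *Introduction to Riemannian Manifolds* (2nd ed., GTM 176, 2018) [LeeRiemannianManifolds2018]
held as `book:lee2018-introduction-riemannian-manifolds` (Prop. 3.12, Problem 3-11, Problem 5-8 read as text).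

CITATION HEADER (lean-in-tree rule).  lit-balaban cell (HOME `run/shared/lean/pub/lit-balaban/`), SKELETON row **F3.Lem1.0**
(+ the §1 setting p. 294 «G a compact Lie Group, d(·,·) an invariant distance constructed from an invariant metric on G»;
reader r17, statement file `…Federbush1986.PureAverages`, p238910 — untouched, not imported here); Phase-2 seat p12 (gen 6),
unit `lit-balaban-p12`, kind «model-instance / generality upgrade»: the tree instantiates the abstract §1 setting only for
`G = SU(2)` (`…Federbush1986.PureAveragesSU2`, great-circle distance on `S³`); this file and its companion
`…Federbush1986.PureAveragesUN` do it for `G = U(N)`, every `N`, with the length metric of the bi-invariant Riemannian metric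
`⟨A, B⟩ = Re tr(A^* B)` [cite: LeeRiemannianManifolds2018, Prop. 3.12 / Problem 3-11] whose geodesics through `1` are the
one-parameter groups `t ↦ e^{tX}` [cite: LeeRiemannianManifolds2018, Problem 5-8].

WHAT IS HERE (all in the Frobenius norm `‖·‖ = ‖·‖_F` of `Matrix n n ℂ`, Mathlib's scoped `Matrix.frobeniusNormedRing`, which is
submultiplicative with `‖1‖ = √n`; `log` = the series (21) `Balaban1983to89.MatrixLog.mlog`):
* §1 the second-order expansion of the logarithmic series in a Banach algebra, `log(1 + P + Q) = log(1 + P) + D_P(Q) + R_P(Q)`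
  (`logOnePlus_add`) with `D_P(Q) = Σ_n c_n Σ_k P^k Q P^{n−1−k}` (`dlog`), `‖D_P(Q) − Q‖ ≤ ‖Q‖‖P‖/(1 − ‖P‖)` (`norm_dlog_sub_le`)
  and `‖R_P(Q)‖ ≤ ‖Q‖²/(1 − t)³` for `‖P‖ + ‖Q‖ ≤ t < 1` (`norm_rlog_le`);
* §2 the trace identity `tr(X · D_P(Q)) = tr(X (1 + P)⁻¹ Q)` for `X` commuting with `P` (`trace_mul_dlog`, cyclicity);
* §3 the Frobenius norm as a real inner-product norm: `‖A‖² = Re tr(A^*A)`, polarization, Cauchy–Schwarz (`frob_norm_add_sq`,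
  `abs_re_trace_conjTranspose_mul_le`);
* §4 the **discrete Gauss lemma** `norm_mlog_exp_mul_exp_le`: for skew `X` and any `Z` with `‖X‖, ‖Z‖ ≤ 1/16`,
  `‖log(e^X e^Z)‖ ≤ ‖X‖ + ‖Z‖ + 20‖Z‖²` — the term linear in `Z` is sharp because by §2 `tr(X^* D_P(e^X(e^Z − 1))) = tr(X^*(e^Z − 1))`;
  this is the inequality that makes the straight chain `1, e^{X/m}, …, e^X` a shortest fine chain in the companion file;
* §5 toolbox for the length metric: `log(X^*) = (log X)^*` (`mlog_star`), `log(U^*XU) = U^*(log X)U` (`mlog_unitary_conj`),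
  unitary invariance of `‖·‖_F` (`frob_norm_unitary_mul`, `frob_norm_mul_unitary`), `(log W)^* = −log W` for unitary `W` near `1`
  (`star_mlog_of_mem_unitaryGroup`), the chordal triangle inequality `norm_star_mul_sub_one_triangle`
  (`e^X ∈ U(n)` for skew `X` is the tree's `QuantumLattice.exp_mem_unitaryGroup_of_star_eq_neg`, not restated).

Everything here is [folklore] matrix analysis, PROVED; no `def … : Prop` facts.  Deliberately NOT here: the carrier `U(N)`, its
length metric and Lemma 1.0 itself (companion file `…Federbush1986.PureAveragesUN`); Lemmas 1.1–1.3 (rows F3.Lem1.1–1.3).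
-/

noncomputable section

open scoped BigOperators
open NormedSpace Finset
open Literature.Analysis.Complex (logOnePlus logSeriesCoeff hasSum_logOnePlus summable_logOnePlus
  norm_logSeriesCoeff_le logSeriesCoeff_succ_mul)

namespace Literature.MathematicalPhysics.QuantumFieldTheory.Federbush1986

namespace UNGauss

variable {𝔄 : Type*} [NormedRing 𝔄]

/-- The part of `(P + Q)ⁿ − Pⁿ` that is linear in `Q`: `Σ_{k<n} Pᵏ Q P^{n−1−k}`. [folklore] -/
private def linPart (P Q : 𝔄) (n : ℕ) : 𝔄 := ∑ k ∈ range n, P ^ k * Q * P ^ (n - 1 - k)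

/-- The remainder of `(P + Q)ⁿ` after the constant and the linear parts in `Q`. [folklore] -/
private def errPart (P Q : 𝔄) (n : ℕ) : 𝔄 := (P + Q) ^ n - P ^ n - linPart P Q n

/-- `linPart P Q 0 = 0`. [folklore] -/
@[simp] private theorem linPart_zero (P Q : 𝔄) : linPart P Q 0 = 0 := by simp [linPart]

/-- `linPart P Q 1 = Q`. [folklore] -/
@[simp] private theorem linPart_one (P Q : 𝔄) : linPart P Q 1 = Q := by simp [linPart]

/-- Recursion `linPart (n+1) = linPart n · P + Pⁿ Q`. [folklore] -/
private theorem linPart_succ (P Q : 𝔄) (n : ℕ) : linPart P Q (n + 1) = linPart P Q n * P + P ^ n * Q := by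
  rw [linPart, linPart, sum_range_succ, sum_mul]
  congr 1
  · refine sum_congr rfl fun k hk => ?_
    rw [mem_range] at hk
    rw [show n + 1 - 1 - k = (n - 1 - k) + 1 by omega, pow_succ, ← mul_assoc]
  · simp

/-- `errPart P Q 0 = 0`. [folklore] -/
@[simp] private theorem errPart_zero (P Q : 𝔄) : errPart P Q 0 = 0 := by simp [errPart]

/-- `errPart P Q 1 = 0`. [folklore] -/
@[simp] private theorem errPart_one (P Q : 𝔄) : errPart P Q 1 = 0 := by simp [errPart]

/-- Recursion `errPart (n+1) = linPart n · Q + errPart n · (P + Q)`. [folklore] -/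
private theorem errPart_succ (P Q : 𝔄) (n : ℕ) :
    errPart P Q (n + 1) = linPart P Q n * Q + errPart P Q n * (P + Q) := by
  rw [errPart, errPart, linPart_succ, pow_succ, pow_succ]
  noncomm_ring

/-- `(P + Q)ⁿ = Pⁿ + linPart + errPart`. [folklore] -/
private theorem add_pow_eq (P Q : 𝔄) (n : ℕ) : (P + Q) ^ n = P ^ n + linPart P Q n + errPart P Q n := by
  rw [errPart]; abel

/-- `‖Pᵏ M‖ ≤ ‖P‖ᵏ ‖M‖` (no hypothesis on `‖1‖`). [folklore] -/
private theorem norm_pow_mul_le (P M : 𝔄) (k : ℕ) : ‖P ^ k * M‖ ≤ ‖P‖ ^ k * ‖M‖ := by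
  induction k with
  | zero => simp
  | succ k ih =>
    rw [pow_succ', mul_assoc, pow_succ']
    calc ‖P * (P ^ k * M)‖ ≤ ‖P‖ * ‖P ^ k * M‖ := norm_mul_le _ _
      _ ≤ ‖P‖ * (‖P‖ ^ k * ‖M‖) := by gcongr
      _ = ‖P‖ * ‖P‖ ^ k * ‖M‖ := by ring

/-- `‖M Pᵏ‖ ≤ ‖M‖ ‖P‖ᵏ` (no hypothesis on `‖1‖`). [folklore] -/
private theorem norm_mul_pow_le (M P : 𝔄) (k : ℕ) : ‖M * P ^ k‖ ≤ ‖M‖ * ‖P‖ ^ k := by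
  induction k with
  | zero => simp
  | succ k ih =>
    rw [pow_succ, ← mul_assoc, pow_succ]
    calc ‖M * P ^ k * P‖ ≤ ‖M * P ^ k‖ * ‖P‖ := norm_mul_le _ _
      _ ≤ ‖M‖ * ‖P‖ ^ k * ‖P‖ := by gcongr
      _ = ‖M‖ * (‖P‖ ^ k * ‖P‖) := mul_assoc _ _ _

/-- `‖linPart P Q n‖ ≤ n ‖P‖^{n−1} ‖Q‖`. [folklore] -/
private theorem norm_linPart_le (P Q : 𝔄) (n : ℕ) : ‖linPart P Q n‖ ≤ n * ‖P‖ ^ (n - 1) * ‖Q‖ := by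
  rw [linPart]
  calc ‖∑ k ∈ range n, P ^ k * Q * P ^ (n - 1 - k)‖ ≤ ∑ k ∈ range n, ‖P ^ k * Q * P ^ (n - 1 - k)‖ :=
        norm_sum_le _ _
    _ ≤ ∑ k ∈ range n, ‖P‖ ^ (n - 1) * ‖Q‖ := by
        refine sum_le_sum fun k hk => ?_
        rw [mem_range] at hk
        calc ‖P ^ k * Q * P ^ (n - 1 - k)‖ ≤ ‖P ^ k * Q‖ * ‖P‖ ^ (n - 1 - k) := norm_mul_pow_le _ _ _
          _ ≤ ‖P‖ ^ k * ‖Q‖ * ‖P‖ ^ (n - 1 - k) := by gcongr; exact norm_pow_mul_le _ _ _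
          _ = ‖P‖ ^ (k + (n - 1 - k)) * ‖Q‖ := by rw [pow_add]; ring
          _ = ‖P‖ ^ (n - 1) * ‖Q‖ := by congr 2; omega
    _ = n * ‖P‖ ^ (n - 1) * ‖Q‖ := by rw [sum_const, card_range, nsmul_eq_mul]; ring

/-- `‖errPart P Q n‖ ≤ C(n,2) t^{n−2} ‖Q‖²` whenever `‖P‖ + ‖Q‖ ≤ t`. [folklore] -/
private theorem norm_errPart_le (P Q : 𝔄) {t : ℝ} (ht : ‖P‖ + ‖Q‖ ≤ t) (n : ℕ) :
    ‖errPart P Q n‖ ≤ (n.choose 2 : ℝ) * t ^ (n - 2) * ‖Q‖ ^ 2 := by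
  have hP : ‖P‖ ≤ t := le_trans (le_add_of_nonneg_right (norm_nonneg Q)) ht
  have ht0 : 0 ≤ t := (norm_nonneg P).trans hP
  have hPQ : ‖P + Q‖ ≤ t := (norm_add_le P Q).trans ht
  induction n with
  | zero => simp
  | succ n ih =>
    rw [errPart_succ]
    have hL : ‖linPart P Q n * Q‖ ≤ n * t ^ (n - 1) * ‖Q‖ ^ 2 := by
      calc ‖linPart P Q n * Q‖ ≤ ‖linPart P Q n‖ * ‖Q‖ := norm_mul_le _ _
        _ ≤ n * ‖P‖ ^ (n - 1) * ‖Q‖ * ‖Q‖ := by gcongr; exact norm_linPart_le P Q n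
        _ ≤ n * t ^ (n - 1) * ‖Q‖ * ‖Q‖ := by gcongr
        _ = n * t ^ (n - 1) * ‖Q‖ ^ 2 := by ring
    have hE : ‖errPart P Q n * (P + Q)‖ ≤ (n.choose 2 : ℝ) * t ^ (n - 2) * ‖Q‖ ^ 2 * t := by
      calc ‖errPart P Q n * (P + Q)‖ ≤ ‖errPart P Q n‖ * ‖P + Q‖ := norm_mul_le _ _
        _ ≤ (n.choose 2 : ℝ) * t ^ (n - 2) * ‖Q‖ ^ 2 * t := by gcongr
    calc ‖linPart P Q n * Q + errPart P Q n * (P + Q)‖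
        ≤ n * t ^ (n - 1) * ‖Q‖ ^ 2 + (n.choose 2 : ℝ) * t ^ (n - 2) * ‖Q‖ ^ 2 * t :=
          (norm_add_le _ _).trans (add_le_add hL hE)
      _ ≤ ((n + 1).choose 2 : ℝ) * t ^ (n + 1 - 2) * ‖Q‖ ^ 2 := by
          rcases n with _ | _ | n
          · simp
          · simp
          · have e1 : n + 1 + 1 - 1 = n + 1 := by omega
            have e2 : n + 1 + 1 - 2 = n := by omega
            have e3 : n + 1 + 1 + 1 - 2 = n + 1 := by omega
            rw [e1, e2, e3, Nat.choose_succ_succ' (n + 1 + 1) 1, Nat.choose_one_right]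
            push_cast
            apply le_of_eq
            ring


/-- `logSeriesCoeff 1 = 1`. [folklore] -/
@[simp] private theorem logSeriesCoeff_one : logSeriesCoeff 1 = 1 := by simp [logSeriesCoeff]

/-! ### Summability of the linear and remainder parts against the logarithmic coefficients -/

section Banach

variable [NormedAlgebra ℂ 𝔄] [CompleteSpace 𝔄]

omit [NormedAlgebra ℂ 𝔄] [CompleteSpace 𝔄] in
/-- `Σ n t^{n−1}` converges for `0 ≤ t < 1`. [folklore] -/
private theorem summable_nat_mul_pow_pred {t : ℝ} (ht0 : 0 ≤ t) (ht : t < 1) :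
    Summable fun n : ℕ => (n : ℝ) * t ^ (n - 1) := by
  have h : Summable (fun n : ℕ => ((n : ℝ) + 1) * t ^ n) := by
    have h1 := summable_pow_mul_geometric_of_norm_lt_one 1 (show ‖t‖ < 1 by rwa [Real.norm_of_nonneg ht0])
    refine (h1.add (summable_geometric_of_lt_one ht0 ht)).congr fun n => ?_
    simp; ring
  refine (summable_nat_add_iff 1).mp ?_
  refine h.congr fun n => ?_
  simp

omit [NormedAlgebra ℂ 𝔄] [CompleteSpace 𝔄] in
/-- `HasSum (n ↦ t^{n+1}) (t/(1−t))`, the geometric tail. [folklore] -/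
private theorem hasSum_pow_succ {t : ℝ} (ht0 : 0 ≤ t) (ht : t < 1) :
    HasSum (fun n : ℕ => t ^ (n + 1)) (t / (1 - t)) := by
  have h := (hasSum_geometric_of_lt_one ht0 ht).mul_left t
  simp_rw [← pow_succ'] at h
  rwa [div_eq_mul_inv]

omit [NormedAlgebra ℂ 𝔄] [CompleteSpace 𝔄] in
/-- `Σ_{n} C(n,2) t^{n−2} = (1 − t)^{−3}` for `0 ≤ t < 1`. [folklore] -/
private theorem hasSum_choose_two_mul_pow {t : ℝ} (ht0 : 0 ≤ t) (ht : t < 1) :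
    HasSum (fun n : ℕ => ((n.choose 2 : ℕ) : ℝ) * t ^ (n - 2)) (1 / (1 - t) ^ 3) := by
  have hn : ‖t‖ < 1 := by rwa [Real.norm_of_nonneg ht0]
  have h2 : HasSum (fun n : ℕ => (((n + 2).choose 2 : ℕ) : ℝ) * t ^ n) (1 / (1 - t) ^ 3) := by
    have := (summable_choose_mul_geometric_of_norm_lt_one 2 hn).hasSum
    rwa [tsum_choose_mul_geometric_of_norm_lt_one 2 hn] at this
  refine (hasSum_nat_add_iff' 2).mp ?_
  simpa [sum_range_succ] using h2

/-- The `Q`-linear series `D_P(Q) = Σ_n c_n linPart P Q n` converges for `‖P‖ < 1`. [folklore] -/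
private theorem summable_smul_linPart {P : 𝔄} (Q : 𝔄) (hP : ‖P‖ < 1) :
    Summable fun n : ℕ => logSeriesCoeff n • linPart P Q n := by
  refine .of_norm_bounded ((summable_nat_mul_pow_pred (norm_nonneg P) hP).mul_right ‖Q‖) fun n => ?_
  calc ‖logSeriesCoeff n • linPart P Q n‖ ≤ ‖logSeriesCoeff n‖ * ‖linPart P Q n‖ := norm_smul_le _ _
    _ ≤ 1 * (n * ‖P‖ ^ (n - 1) * ‖Q‖) :=
        mul_le_mul (norm_logSeriesCoeff_le n) (norm_linPart_le P Q n) (norm_nonneg _) zero_le_one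
    _ = n * ‖P‖ ^ (n - 1) * ‖Q‖ := one_mul _

/-- The remainder series `R_P(Q) = Σ_n c_n errPart P Q n` converges for `‖P‖ + ‖Q‖ < 1`. [folklore] -/
private theorem summable_smul_errPart {P Q : 𝔄} (h : ‖P‖ + ‖Q‖ < 1) :
    Summable fun n : ℕ => logSeriesCoeff n • errPart P Q n := by
  have ht0 : 0 ≤ ‖P‖ + ‖Q‖ := by positivity
  refine .of_norm_bounded (((hasSum_choose_two_mul_pow ht0 h).summable).mul_right (‖Q‖ ^ 2)) fun n => ?_
  calc ‖logSeriesCoeff n • errPart P Q n‖ ≤ ‖logSeriesCoeff n‖ * ‖errPart P Q n‖ := norm_smul_le _ _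
    _ ≤ 1 * ((n.choose 2 : ℝ) * (‖P‖ + ‖Q‖) ^ (n - 2) * ‖Q‖ ^ 2) :=
        mul_le_mul (norm_logSeriesCoeff_le n) (norm_errPart_le P Q le_rfl n) (norm_nonneg _) zero_le_one
    _ = ((n.choose 2 : ℕ) : ℝ) * (‖P‖ + ‖Q‖) ^ (n - 2) * ‖Q‖ ^ 2 := by ring

/-- The `Q`-linear part of `log(1 + P + Q) − log(1 + P)`: `D_P(Q) := Σ_{n≥1} ((−1)^{n+1}/n) Σ_{k<n} Pᵏ Q P^{n−1−k}`.
[folklore] -/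
private def dlog (P Q : 𝔄) : 𝔄 := ∑' n : ℕ, logSeriesCoeff n • linPart P Q n

/-- The second-order remainder of `log(1 + P + Q) − log(1 + P)`. [folklore] -/
private def rlog (P Q : 𝔄) : 𝔄 := ∑' n : ℕ, logSeriesCoeff n • errPart P Q n

/-- **Second-order expansion of the logarithmic series**: for `‖P‖ + ‖Q‖ < 1`,
`log(1 + P + Q) = log(1 + P) + D_P(Q) + R_P(Q)`. [folklore] -/
private theorem logOnePlus_add (P Q : 𝔄) (h : ‖P‖ + ‖Q‖ < 1) :
    logOnePlus (P + Q) = logOnePlus P + dlog P Q + rlog P Q := by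
  have hP : ‖P‖ < 1 := lt_of_le_of_lt (le_add_of_nonneg_right (norm_nonneg Q)) h
  have hPQ : ‖P + Q‖ < 1 := lt_of_le_of_lt (norm_add_le P Q) h
  have h1 := hasSum_logOnePlus hP
  have h2 := (summable_smul_linPart Q hP).hasSum
  have h3 := (summable_smul_errPart h).hasSum
  have h4 := hasSum_logOnePlus hPQ
  have hsum : HasSum (fun n : ℕ => logSeriesCoeff n • (P + Q) ^ n) (logOnePlus P + dlog P Q + rlog P Q) := by
    refine ((h1.add h2).add h3).congr_fun fun n => ?_
    rw [add_pow_eq, smul_add, smul_add]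
  exact h4.unique hsum

omit [CompleteSpace 𝔄] in
/-- `‖c_n‖ = 1/n` for `n ≥ 1`. [folklore] -/
private theorem norm_logSeriesCoeff_eq (n : ℕ) : ‖logSeriesCoeff n‖ = 1 / n := by
  rw [logSeriesCoeff, norm_div, norm_pow, norm_neg, norm_one, one_pow, Complex.norm_natCast]

/-- `‖D_P(Q) − Q‖ ≤ ‖Q‖‖P‖/(1 − ‖P‖)`: the linear part is `Q` up to terms carrying a factor `P`. [folklore] -/
private theorem norm_dlog_sub_le (P Q : 𝔄) (hP : ‖P‖ < 1) :
    ‖dlog P Q - Q‖ ≤ ‖Q‖ * (‖P‖ / (1 - ‖P‖)) := by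
  have hs := summable_smul_linPart Q hP
  have hs1 : Summable fun n : ℕ => logSeriesCoeff (n + 1) • linPart P Q (n + 1) :=
    (summable_nat_add_iff (f := fun n : ℕ => logSeriesCoeff n • linPart P Q n) 1).mpr hs
  have e0 : dlog P Q = ∑' n : ℕ, logSeriesCoeff (n + 1) • linPart P Q (n + 1) := by
    rw [dlog, hs.tsum_eq_zero_add, linPart_zero, smul_zero, zero_add]
  have e1 : dlog P Q - Q = ∑' n : ℕ, logSeriesCoeff (n + 1 + 1) • linPart P Q (n + 1 + 1) := by
    rw [e0, hs1.tsum_eq_zero_add, linPart_one, logSeriesCoeff_one, one_smul, add_sub_cancel_left]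
  rw [e1]
  have hg : HasSum (fun n : ℕ => ‖Q‖ * ‖P‖ ^ (n + 1)) (‖Q‖ * (‖P‖ / (1 - ‖P‖))) :=
    (hasSum_pow_succ (norm_nonneg P) hP).mul_left ‖Q‖
  refine tsum_of_norm_bounded hg fun n => ?_
  have hn2 : (0 : ℝ) < (n : ℝ) + 1 + 1 := by positivity
  have hc : ‖logSeriesCoeff (n + 1 + 1)‖ = 1 / ((n : ℝ) + 1 + 1) := by
    rw [norm_logSeriesCoeff_eq]; push_cast; ring
  have hL : ‖linPart P Q (n + 1 + 1)‖ ≤ ((n : ℝ) + 1 + 1) * ‖P‖ ^ (n + 1) * ‖Q‖ := by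
    have h := norm_linPart_le P Q (n + 1 + 1)
    rw [show n + 1 + 1 - 1 = n + 1 by omega] at h
    push_cast at h
    exact h
  calc ‖logSeriesCoeff (n + 1 + 1) • linPart P Q (n + 1 + 1)‖
      ≤ ‖logSeriesCoeff (n + 1 + 1)‖ * ‖linPart P Q (n + 1 + 1)‖ := norm_smul_le _ _
    _ ≤ (1 / ((n : ℝ) + 1 + 1)) * (((n : ℝ) + 1 + 1) * ‖P‖ ^ (n + 1) * ‖Q‖) :=
        mul_le_mul hc.le hL (norm_nonneg _) (by positivity)
    _ = ‖Q‖ * ‖P‖ ^ (n + 1) := by field_simp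

omit [CompleteSpace 𝔄] in
/-- `‖R_P(Q)‖ ≤ ‖Q‖²/(1 − t)³` whenever `‖P‖ + ‖Q‖ ≤ t < 1`. [folklore] -/
private theorem norm_rlog_le (P Q : 𝔄) {t : ℝ} (hPQ : ‖P‖ + ‖Q‖ ≤ t) (ht : t < 1) :
    ‖rlog P Q‖ ≤ ‖Q‖ ^ 2 * (1 / (1 - t) ^ 3) := by
  have ht0 : 0 ≤ t := le_trans (by positivity) hPQ
  have hg : HasSum (fun n : ℕ => ‖Q‖ ^ 2 * (((n.choose 2 : ℕ) : ℝ) * t ^ (n - 2))) (‖Q‖ ^ 2 * (1 / (1 - t) ^ 3)) :=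
    (hasSum_choose_two_mul_pow ht0 ht).mul_left (‖Q‖ ^ 2)
  refine tsum_of_norm_bounded hg fun n => ?_
  calc ‖logSeriesCoeff n • errPart P Q n‖ ≤ ‖logSeriesCoeff n‖ * ‖errPart P Q n‖ := norm_smul_le _ _
    _ ≤ 1 * ((n.choose 2 : ℝ) * t ^ (n - 2) * ‖Q‖ ^ 2) :=
        mul_le_mul (norm_logSeriesCoeff_le n) (norm_errPart_le P Q hPQ n) (norm_nonneg _) zero_le_one
    _ = ‖Q‖ ^ 2 * (((n.choose 2 : ℕ) : ℝ) * t ^ (n - 2)) := by ring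

end Banach


/-! ### The trace identity `tr(X · D_P(Q)) = tr(X (1+P)⁻¹ Q)` for `X` commuting with `P` -/

section Trace

open scoped Matrix.Norms.Frobenius

variable {n : Type*} [Fintype n] [DecidableEq n]

/-- `tr(X · linPart P Q m) = m · tr(X P^{m−1} Q)` when `X` commutes with `P` (cyclicity of the trace). [folklore] -/
private theorem trace_mul_linPart {X P : Matrix n n ℂ} (Q : Matrix n n ℂ) (hXP : Commute X P) (m : ℕ) :
    (X * linPart P Q m).trace = m * (X * P ^ (m - 1) * Q).trace := by
  rw [linPart, mul_sum, Matrix.trace_sum]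
  have hterm : ∀ k ∈ range m, (X * (P ^ k * Q * P ^ (m - 1 - k))).trace = (X * P ^ (m - 1) * Q).trace := by
    intro k hk
    rw [mem_range] at hk
    have e : X * (P ^ k * Q * P ^ (m - 1 - k)) = (X * P ^ k) * Q * P ^ (m - 1 - k) := by noncomm_ring
    rw [e, Matrix.trace_mul_cycle, ← mul_assoc, ← (hXP.pow_right (m - 1 - k)).eq, mul_assoc X, ← pow_add,
      show m - 1 - k + k = m - 1 by omega]
  rw [sum_congr rfl hterm, sum_const, card_range, nsmul_eq_mul]

omit [DecidableEq n] in
/-- The trace is continuous (finite dimensions). [folklore] -/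
private theorem continuous_trace : Continuous fun M : Matrix n n ℂ => M.trace :=
  (Matrix.traceLinearMap n ℂ ℂ).continuous_of_finiteDimensional

/-- **Trace identity.** For `X` commuting with `P`, `‖P‖ < 1`:
`tr(X · D_P(Q)) = tr(X · S · Q)` with `S = Σ_m (−P)^m` the inverse of `1 + P`. [folklore] -/
private theorem trace_mul_dlog {X P : Matrix n n ℂ} (Q : Matrix n n ℂ) (hXP : Commute X P) (hP : ‖P‖ < 1) :
    (X * dlog P Q).trace = (X * (∑' m : ℕ, (-P) ^ m) * Q).trace := by
  -- the series for `tr(X · D_P(Q))`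
  have h1 : HasSum (fun k : ℕ => (X * (logSeriesCoeff k • linPart P Q k)).trace) (X * dlog P Q).trace :=
    ((summable_smul_linPart Q hP).hasSum.mul_left X).map (Matrix.traceLinearMap n ℂ ℂ) continuous_trace
  have hg : ∀ k : ℕ, (X * (logSeriesCoeff k • linPart P Q k)).trace
      = (logSeriesCoeff k * k) * (X * P ^ (k - 1) * Q).trace := by
    intro k
    rw [mul_smul_comm, Matrix.trace_smul, smul_eq_mul, trace_mul_linPart Q hXP k]
    ring
  simp_rw [hg] at h1
  -- shift by one: the `k = 0` term vanishes and `c_{m+1}(m+1) = (−1)^m`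
  have h2 : HasSum (fun m : ℕ => (X * (-P) ^ m * Q).trace) (X * dlog P Q).trace := by
    have h1' := (hasSum_nat_add_iff' 1).mpr h1
    simp only [range_one, sum_singleton, Nat.cast_zero, mul_zero, zero_mul, sub_zero] at h1'
    refine h1'.congr_fun fun m => ?_
    have e : logSeriesCoeff (m + 1) * ((m + 1 : ℕ) : ℂ) = (-1) ^ m := by
      push_cast; exact logSeriesCoeff_succ_mul m
    rw [e, show m + 1 - 1 = m by omega, show -P = (-1 : ℂ) • P by simp, smul_pow, mul_smul_comm,
      smul_mul_assoc, Matrix.trace_smul, smul_eq_mul]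
  -- the geometric series
  have hP' : ‖-P‖ < 1 := by rwa [norm_neg]
  have h3 : HasSum (fun m : ℕ => (X * (-P) ^ m * Q).trace) (X * (∑' m : ℕ, (-P) ^ m) * Q).trace := by
    have hs := (summable_geometric_of_norm_lt_one hP').hasSum
    have := ((hs.mul_left X).mul_right Q).map (Matrix.traceLinearMap n ℂ ℂ) continuous_trace
    exact this
  exact h2.unique h3

omit [DecidableEq n] in
/-- `(Σ_m (−P)^m)(1 + P) = 1` for `‖P‖ < 1`. [folklore] -/
private theorem geom_neg_mul_one_add [DecidableEq n] {P : Matrix n n ℂ} (hP : ‖P‖ < 1) :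
    (∑' m : ℕ, (-P) ^ m) * (1 + P) = 1 := by
  have h := geom_series_mul_neg (-P) (by rwa [norm_neg])
  rwa [sub_neg_eq_add] at h

end Trace

/-! ### The Frobenius norm as a real inner-product norm: `‖A‖² = Re tr(Aᴴ A)`, polarization, Cauchy–Schwarz -/

section Frobenius

open scoped Matrix.Norms.Frobenius ComplexConjugate Matrix

variable {n : Type*} [Fintype n]

/-- `‖A‖_F² = Σ_{ij} |A_{ij}|²` — the norm of the invariant metric `⟨A, B⟩ = Re tr(A^*B)` of `G = U(N)` («an invariant
metric on G»). [cite: Federbush1987PhaseCellIII, §1 p. 294] [cite: LeeRiemannianManifolds2018, Problem 3-11] -/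
theorem frob_norm_sq (A : Matrix n n ℂ) : ‖A‖ ^ 2 = ∑ i, ∑ j, ‖A i j‖ ^ 2 := by
  rw [Matrix.frobenius_norm_def]
  have hS : 0 ≤ ∑ i, ∑ j, ‖A i j‖ ^ (2 : ℝ) := by positivity
  rw [← Real.rpow_natCast _ 2, ← Real.rpow_mul hS]
  norm_num

/-- `Re tr(Aᴴ B) = Σ_{ij} Re(conj A_{ij} · B_{ij})` — the invariant inner product in coordinates. [cite: Federbush1987PhaseCellIII, §1 p. 294] [cite: LeeRiemannianManifolds2018, Problem 3-11] -/
theorem re_trace_conjTranspose_mul (A B : Matrix n n ℂ) :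
    ((Aᴴ * B).trace).re = ∑ i, ∑ j, (conj (A i j) * B i j).re := by
  rw [Matrix.trace]
  simp only [Matrix.diag_apply, Matrix.mul_apply, Matrix.conjTranspose_apply, Complex.star_def,
    Complex.re_sum]
  rw [Finset.sum_comm]

/-- `‖A‖_F² = Re tr(Aᴴ A)`: the Frobenius norm is the norm of the invariant metric `⟨A, B⟩ = Re tr(A^*B)`. [cite: Federbush1987PhaseCellIII, §1 p. 294] [cite: LeeRiemannianManifolds2018, Problem 3-11] -/
theorem frob_norm_sq_eq_re_trace (A : Matrix n n ℂ) : ‖A‖ ^ 2 = ((Aᴴ * A).trace).re := by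
  rw [frob_norm_sq, re_trace_conjTranspose_mul]
  refine sum_congr rfl fun i _ => sum_congr rfl fun j _ => ?_
  rw [Complex.conj_mul', ← Complex.ofReal_pow, Complex.ofReal_re]

/-- Cauchy–Schwarz for the invariant metric: `|Re tr(Aᴴ B)| ≤ ‖A‖_F ‖B‖_F`. [cite: Federbush1987PhaseCellIII, §1 p. 294] [cite: LeeRiemannianManifolds2018, Problem 3-11] -/
theorem abs_re_trace_conjTranspose_mul_le (A B : Matrix n n ℂ) :
    |((Aᴴ * B).trace).re| ≤ ‖A‖ * ‖B‖ := by
  rw [re_trace_conjTranspose_mul]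
  have h1 : |∑ i, ∑ j, (conj (A i j) * B i j).re| ≤ ∑ i, ∑ j, ‖A i j‖ * ‖B i j‖ := by
    refine (abs_sum_le_sum_abs _ _).trans (sum_le_sum fun i _ => ?_)
    refine (abs_sum_le_sum_abs _ _).trans (sum_le_sum fun j _ => ?_)
    calc |(conj (A i j) * B i j).re| ≤ ‖conj (A i j) * B i j‖ := Complex.abs_re_le_norm _
      _ = ‖A i j‖ * ‖B i j‖ := by rw [norm_mul, Complex.norm_conj]
  refine h1.trans ?_
  -- Cauchy–Schwarz on the index set n × n
  have hcs := sum_mul_sq_le_sq_mul_sq (univ : Finset (n × n)) (fun p => ‖A p.1 p.2‖) (fun p => ‖B p.1 p.2‖)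
  have eA : ∑ p ∈ (univ : Finset (n × n)), ‖A p.1 p.2‖ ^ 2 = ‖A‖ ^ 2 := by
    rw [frob_norm_sq, ← Finset.sum_product']; rfl
  have eB : ∑ p ∈ (univ : Finset (n × n)), ‖B p.1 p.2‖ ^ 2 = ‖B‖ ^ 2 := by
    rw [frob_norm_sq, ← Finset.sum_product']; rfl
  have eAB : ∑ p ∈ (univ : Finset (n × n)), ‖A p.1 p.2‖ * ‖B p.1 p.2‖ = ∑ i, ∑ j, ‖A i j‖ * ‖B i j‖ := by
    rw [← Finset.sum_product']; rfl
  rw [eA, eB, eAB] at hcs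
  have hnn : 0 ≤ ∑ i, ∑ j, ‖A i j‖ * ‖B i j‖ := by positivity
  nlinarith [norm_nonneg A, norm_nonneg B, mul_nonneg (norm_nonneg A) (norm_nonneg B)]

/-- Polarization for the invariant metric: `‖A + B‖_F² = ‖A‖_F² + 2 Re tr(Aᴴ B) + ‖B‖_F²`. [cite: Federbush1987PhaseCellIII, §1 p. 294] [cite: LeeRiemannianManifolds2018, Problem 3-11] -/
theorem frob_norm_add_sq (A B : Matrix n n ℂ) :
    ‖A + B‖ ^ 2 = ‖A‖ ^ 2 + 2 * ((Aᴴ * B).trace).re + ‖B‖ ^ 2 := by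
  rw [frob_norm_sq_eq_re_trace, frob_norm_sq_eq_re_trace, frob_norm_sq_eq_re_trace,
    Matrix.conjTranspose_add, add_mul, mul_add, mul_add, Matrix.trace_add, Matrix.trace_add,
    Matrix.trace_add]
  have hBA : ((Bᴴ * A).trace).re = ((Aᴴ * B).trace).re := by
    rw [← Matrix.conjTranspose_conjTranspose A, ← Matrix.conjTranspose_mul, Matrix.trace_conjTranspose,
      Matrix.conjTranspose_conjTranspose, Complex.star_def, Complex.conj_re]
  simp only [Complex.add_re]
  rw [hBA]; ring

end Frobenius

/-! ### The discrete Gauss lemma: `‖log(e^X e^Z)‖ ≤ ‖X‖ + ‖Z‖ + 20‖Z‖²` for skew `X` -/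

section Key

open scoped Matrix.Norms.Frobenius ComplexConjugate Matrix
open Literature.MathematicalPhysics.QuantumFieldTheory.Balaban1983to89.MatrixLog (mlog mlog_def)
open Literature.MathematicalPhysics.QuantumFieldTheory.Balaban1983to89.B7BlockAvgLog (mlog_exp)

variable {n : Type*} [Fintype n] [DecidableEq n]

omit [Fintype n] [DecidableEq n] in
/-- Real bookkeeping behind the discrete Gauss lemma: the second-order terms collected. [folklore] -/
private theorem key_real {x z p e q dq r a b c s Y : ℝ}
    (hx0 : 0 ≤ x) (hx : x ≤ 1 / 16) (hz0 : 0 ≤ z) (hz : z ≤ 1 / 16)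
    (hp0 : 0 ≤ p) (hp : p ≤ x + x ^ 2) (he0 : 0 ≤ e) (he : e ≤ z + z ^ 2)
    (hq0 : 0 ≤ q) (hq : q ≤ e + p * e) (hdq : dq ≤ 2 * (q * p))
    (hr : r ≤ 8 * q ^ 2)
    (ha : a ≤ x * z) (hb : b ≤ x * z ^ 2) (hc : c ≤ x * r)
    (hs0 : 0 ≤ s) (hs : s ≤ q + dq + r) (hY0 : 0 ≤ Y)
    (hY : Y ^ 2 ≤ x ^ 2 + 2 * (a + b + c) + s ^ 2) :
    Y ≤ x + z + 20 * z ^ 2 := by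
  have hp1 : p ≤ 17 / 16 * x := by nlinarith [mul_le_mul_of_nonneg_left hx hx0]
  have he1 : e ≤ 17 / 16 * z := by nlinarith [mul_le_mul_of_nonneg_left hz hz0]
  have hq1 : q ≤ z + z ^ 2 + 289 / 256 * (x * z) := by
    nlinarith [mul_le_mul hp1 he1 he0 (by positivity)]
  have hq2 : q ≤ 7 / 6 * z := by
    nlinarith [mul_le_mul_of_nonneg_left hz hz0, mul_le_mul_of_nonneg_right hx hz0]
  have hdq1 : dq ≤ 119 / 48 * (x * z) := by
    nlinarith [mul_le_mul hq2 hp1 hp0 (by positivity)]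
  have hr1 : r ≤ 98 / 9 * z ^ 2 := by
    nlinarith [mul_le_mul hq2 hq2 hq0 (by positivity)]
  have hs1 : s ≤ z + (12 * z ^ 2 + 4 * (x * z)) := by
    nlinarith [sq_nonneg z, mul_nonneg hx0 hz0]
  have hc1 : 12 * z + 4 * x ≤ 1 := by linarith
  have hc0 : 0 ≤ 12 * z + 4 * x := by positivity
  have hs2 : s ^ 2 ≤ z ^ 2 + 12 * (x * z ^ 2) + 36 * z ^ 3 := by
    have h1 : s ^ 2 ≤ (z + (12 * z ^ 2 + 4 * (x * z))) ^ 2 := pow_le_pow_left₀ hs0 hs1 2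
    have h2 : (z + (12 * z ^ 2 + 4 * (x * z))) ^ 2
        = z ^ 2 + z ^ 2 * (12 * z + 4 * x) * (2 + (12 * z + 4 * x)) := by ring
    have h3 : z ^ 2 * (12 * z + 4 * x) * (2 + (12 * z + 4 * x)) ≤ z ^ 2 * (12 * z + 4 * x) * 3 :=
      mul_le_mul_of_nonneg_left (by linarith) (mul_nonneg (sq_nonneg z) hc0)
    nlinarith
  have hM : Y ^ 2 ≤ (x + z + 20 * z ^ 2) ^ 2 := by
    nlinarith [mul_le_mul_of_nonneg_left hb le_rfl, mul_le_mul_of_nonneg_left hr1 hx0,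
      mul_nonneg hx0 (sq_nonneg z), pow_nonneg hz0 3, pow_nonneg hz0 4]
  exact (pow_le_pow_iff_left₀ hY0 (by positivity) two_ne_zero).1 hM

omit [Fintype n] [DecidableEq n] in
/-- `e^x − 1 ≤ x + x²` for `0 ≤ x ≤ 1`. [folklore] -/
private theorem real_exp_sub_one_le_add_sq {x : ℝ} (hx0 : 0 ≤ x) (hx : x ≤ 1) : Real.exp x - 1 ≤ x + x ^ 2 := by
  have h := Real.abs_exp_sub_one_sub_id_le (x := x) (by rwa [abs_of_nonneg hx0])
  have h' := (le_abs_self _).trans h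
  linarith

/-- `‖e^X − 1‖ ≤ ‖X‖ + ‖X‖²` for `‖X‖ ≤ 1` (Frobenius norm; no hypothesis on `‖1‖`) — the size of one fine step
`e^{X/m}` of the straight chain in the proof of Lemma 1.0 for `G = U(N)`. [cite: Federbush1987PhaseCellIII, Lemma 1.0 (1.3) p. 295] -/
theorem norm_exp_sub_one_le_add_sq {X : Matrix n n ℂ} (hX : ‖X‖ ≤ 1) : ‖exp X - 1‖ ≤ ‖X‖ + ‖X‖ ^ 2 :=
  (Literature.Analysis.Calculus.norm_exp_sub_one_le X).trans
    (real_exp_sub_one_le_add_sq (norm_nonneg X) hX)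

/-- **Discrete Gauss lemma** (the infinitesimal form of "radial geodesics from `1` are minimizing",
[cite: LeeRiemannianManifolds2018, Prop. 3.12 / Problem 3-11 / Problem 5-8], for the bi-invariant Frobenius
metric on `U(N)`): for skew `X` and any `Z` with `‖X‖_F, ‖Z‖_F ≤ 1/16`,
`‖log(e^X e^Z)‖_F ≤ ‖X‖_F + ‖Z‖_F + 20 ‖Z‖_F²`.
The first-order term in `Z` is exactly `‖Z‖_F` because `tr(X^* · D_P(Q)) = tr(X^* (e^Z − 1))` by cyclicity of the
trace (`trace_mul_dlog`), the dependence on `P = e^X − 1` dropping out.  The step of OUR proof of Lemma 1.0 (1.3)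
`d(1, e^A) = |A|` for `G = U(N)` that bounds the length of every fine chain from below. [cite: Federbush1987PhaseCellIII, Lemma 1.0 (1.3) p. 295] [cite: LeeRiemannianManifolds2018, Problem 5-8] -/
theorem norm_mlog_exp_mul_exp_le {X Z : Matrix n n ℂ} (hX : star X = -X) (hx : ‖X‖ ≤ 1 / 16)
    (hz : ‖Z‖ ≤ 1 / 16) : ‖mlog (exp X * exp Z)‖ ≤ ‖X‖ + ‖Z‖ + 20 * ‖Z‖ ^ 2 := by
  obtain ⟨P, hPdef⟩ : ∃ P : Matrix n n ℂ, P = exp X - 1 := ⟨_, rfl⟩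
  obtain ⟨E, hEdef⟩ : ∃ E : Matrix n n ℂ, E = exp Z - 1 := ⟨_, rfl⟩
  obtain ⟨E₂, hE₂def⟩ : ∃ E₂ : Matrix n n ℂ, E₂ = exp Z - 1 - Z := ⟨_, rfl⟩
  obtain ⟨Q, hQdef⟩ : ∃ Q : Matrix n n ℂ, Q = exp X * E := ⟨_, rfl⟩
  have hx1 : ‖X‖ ≤ 1 := hx.trans (by norm_num)
  have hz1 : ‖Z‖ ≤ 1 := hz.trans (by norm_num)
  -- the elementary bounds on `P`, `E`, `E₂`, `Q`
  have hP : ‖P‖ ≤ ‖X‖ + ‖X‖ ^ 2 := hPdef ▸ norm_exp_sub_one_le_add_sq hx1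
  have hE : ‖E‖ ≤ ‖Z‖ + ‖Z‖ ^ 2 := hEdef ▸ norm_exp_sub_one_le_add_sq hz1
  have hE₂ : ‖E₂‖ ≤ ‖Z‖ ^ 2 := hE₂def ▸ OneLinkLaplace.norm_exp_sub_one_sub_le_sq hz1
  have hUP : exp X = 1 + P := by rw [hPdef]; abel
  have hEZ : E = Z + E₂ := by rw [hEdef, hE₂def]; abel
  have hQPE : Q = E + P * E := by rw [hQdef, hUP]; noncomm_ring
  have hQ : ‖Q‖ ≤ ‖E‖ + ‖P‖ * ‖E‖ := by
    rw [hQPE]; exact (norm_add_le _ _).trans (add_le_add le_rfl (norm_mul_le _ _))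
  have hPs : ‖P‖ ≤ 17 / 256 := by nlinarith [norm_nonneg X]
  have hEs : ‖E‖ ≤ 17 / 256 := by nlinarith [norm_nonneg Z]
  have hQs : ‖Q‖ ≤ 1 / 8 := by nlinarith [norm_nonneg P, norm_nonneg E]
  have hP1 : ‖P‖ < 1 := by linarith
  have ht : ‖P‖ + ‖Q‖ < 1 := by linarith
  -- the product and its logarithm: `log(e^X e^Z) = X + D_P(Q) + R_P(Q)`
  have hprod : exp X * exp Z - 1 = P + Q := by
    rw [hQdef, hEdef, hPdef]; noncomm_ring
  have hlog2 : ‖X‖ < Real.log 2 := by have := Real.log_two_gt_d9; linarith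
  have hLP : logOnePlus P = X := by rw [hPdef, ← mlog_def]; exact mlog_exp hlog2
  have hY : mlog (exp X * exp Z) = X + (dlog P Q + rlog P Q) := by
    rw [mlog_def, hprod, logOnePlus_add P Q ht, hLP, add_assoc]
  -- the trace identity: `tr(Xᴴ D_P(Q)) = tr(Xᴴ E)`
  have hXh : Xᴴ = -X := by rw [← Matrix.star_eq_conjTranspose]; exact hX
  have hXP : Commute Xᴴ P := by
    rw [hXh, hPdef]
    exact ((Commute.refl X).exp_right.sub_right (Commute.one_right X)).neg_left
  have hSU : (∑' m : ℕ, (-P) ^ m) * exp X = 1 := by rw [hUP]; exact geom_neg_mul_one_add hP1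
  have htrD : (Xᴴ * dlog P Q).trace = (Xᴴ * E).trace := by
    rw [trace_mul_dlog Q hXP hP1, hQdef,
      show Xᴴ * (∑' m : ℕ, (-P) ^ m) * (exp X * E) = Xᴴ * ((∑' m : ℕ, (-P) ^ m) * exp X) * E by
        simp only [mul_assoc], hSU, mul_one]
  have hre : ((Xᴴ * (dlog P Q + rlog P Q)).trace).re
      = ((Xᴴ * Z).trace).re + ((Xᴴ * E₂).trace).re + ((Xᴴ * rlog P Q).trace).re := by
    rw [mul_add, Matrix.trace_add, htrD, hEZ, mul_add, Matrix.trace_add]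
    simp only [Complex.add_re]
  -- the second-order bounds
  have hdq : ‖dlog P Q - Q‖ ≤ 2 * (‖Q‖ * ‖P‖) := by
    have h1 : ‖P‖ / (1 - ‖P‖) ≤ 2 * ‖P‖ := by
      rw [div_le_iff₀ (by linarith)]; nlinarith [norm_nonneg P]
    calc ‖dlog P Q - Q‖ ≤ ‖Q‖ * (‖P‖ / (1 - ‖P‖)) := norm_dlog_sub_le P Q hP1
      _ ≤ ‖Q‖ * (2 * ‖P‖) := by gcongr
      _ = 2 * (‖Q‖ * ‖P‖) := by ring
  have hR8 : ‖rlog P Q‖ ≤ 8 * ‖Q‖ ^ 2 := by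
    have h1 : 1 / (1 - (‖P‖ + ‖Q‖)) ^ 3 ≤ 8 := by
      have h2 : (1 : ℝ) / 2 ≤ 1 - (‖P‖ + ‖Q‖) := by linarith
      have h3 := pow_le_pow_left₀ (by norm_num) h2 3
      rw [div_le_iff₀ (by positivity)]
      nlinarith
    calc ‖rlog P Q‖ ≤ ‖Q‖ ^ 2 * (1 / (1 - (‖P‖ + ‖Q‖)) ^ 3) := norm_rlog_le P Q le_rfl ht
      _ ≤ ‖Q‖ ^ 2 * 8 := by gcongr
      _ = 8 * ‖Q‖ ^ 2 := by ring
  have ha : ((Xᴴ * Z).trace).re ≤ ‖X‖ * ‖Z‖ := (le_abs_self _).trans (abs_re_trace_conjTranspose_mul_le X Z)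
  have hb : ((Xᴴ * E₂).trace).re ≤ ‖X‖ * ‖Z‖ ^ 2 :=
    (le_abs_self _).trans ((abs_re_trace_conjTranspose_mul_le X E₂).trans
      (mul_le_mul_of_nonneg_left hE₂ (norm_nonneg X)))
  have hc : ((Xᴴ * rlog P Q).trace).re ≤ ‖X‖ * ‖rlog P Q‖ :=
    (le_abs_self _).trans (abs_re_trace_conjTranspose_mul_le X _)
  have hs : ‖dlog P Q + rlog P Q‖ ≤ ‖Q‖ + ‖dlog P Q - Q‖ + ‖rlog P Q‖ :=
    (norm_add_le _ _).trans (add_le_add (norm_le_insert' _ _) le_rfl)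
  have hfin : ‖X + (dlog P Q + rlog P Q)‖ ^ 2 ≤ ‖X‖ ^ 2
      + 2 * (((Xᴴ * Z).trace).re + ((Xᴴ * E₂).trace).re + ((Xᴴ * rlog P Q).trace).re)
      + ‖dlog P Q + rlog P Q‖ ^ 2 := by
    rw [frob_norm_add_sq, hre]
  rw [hY]
  exact key_real (norm_nonneg X) hx (norm_nonneg Z) hz (norm_nonneg P) hP (norm_nonneg E) hE
    (norm_nonneg Q) hQ hdq hR8 ha hb hc (norm_nonneg _) hs (norm_nonneg _) hfin

end Key

/-! ### Toolbox for the length metric: `star`, unitary conjugation and unitary invariance -/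

section Toolbox

open scoped Matrix.Norms.Frobenius ComplexConjugate Matrix
open Literature.MathematicalPhysics.QuantumFieldTheory.Balaban1983to89.MatrixLog (mlog mlog_def hasSum_mlog
  exp_mlog norm_mlog_le_two_mul)
open Literature.MathematicalPhysics.QuantumFieldTheory.Balaban1983to89.B7BlockAvgLog (mlog_exp
  commute_mlog_right eq_zero_of_exp_eq_one)

variable {n : Type*} [Fintype n] [DecidableEq n]

omit [Fintype n] [DecidableEq n] in
/-- The logarithmic coefficients are real: `conj c_k = c_k`. [folklore] -/
@[simp] private theorem star_logSeriesCoeff (k : ℕ) : star (logSeriesCoeff k) = logSeriesCoeff k := by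
  rw [logSeriesCoeff, Complex.star_def, map_div₀, map_pow, map_neg, map_one, map_natCast]

/-- `log (X^*) = (log X)^*` for the series (21) — symmetry `d(U, V) = d(V, U)` of the length metric of `G = U(N)` at the
level of one step. [cite: Federbush1987PhaseCellIII, §1 p. 294] -/
theorem mlog_star (X : Matrix n n ℂ) : mlog (star X) = star (mlog X) := by
  rw [mlog_def, mlog_def, Literature.Analysis.Complex.logOnePlus, Literature.Analysis.Complex.logOnePlus,
    tsum_star]
  refine tsum_congr fun k => ?_
  rw [star_smul, star_logSeriesCoeff, star_pow, star_sub, star_one]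

/-- `‖U A‖_F = ‖A‖_F` for unitary `U`: left invariance of «an invariant metric on G», `G = U(N)`. [cite: Federbush1987PhaseCellIII, §1 p. 294] [cite: LeeRiemannianManifolds2018, Problem 3-11] -/
theorem frob_norm_unitary_mul {U : Matrix n n ℂ} (hU : U ∈ Matrix.unitaryGroup n ℂ) (A : Matrix n n ℂ) :
    ‖U * A‖ = ‖A‖ := by
  have h : ‖U * A‖ ^ 2 = ‖A‖ ^ 2 := by
    rw [frob_norm_sq_eq_re_trace, frob_norm_sq_eq_re_trace, Matrix.conjTranspose_mul,
      show Aᴴ * Uᴴ * (U * A) = Aᴴ * (Uᴴ * U) * A by simp only [mul_assoc], ← Matrix.star_eq_conjTranspose U,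
      Matrix.mem_unitaryGroup_iff'.mp hU, mul_one]
  exact (sq_eq_sq₀ (norm_nonneg _) (norm_nonneg _)).1 h

/-- `‖A U‖_F = ‖A‖_F` for unitary `U`: right invariance of «an invariant metric on G», `G = U(N)`. [cite: Federbush1987PhaseCellIII, §1 p. 294] [cite: LeeRiemannianManifolds2018, Problem 3-11] -/
theorem frob_norm_mul_unitary {U : Matrix n n ℂ} (hU : U ∈ Matrix.unitaryGroup n ℂ) (A : Matrix n n ℂ) :
    ‖A * U‖ = ‖A‖ := by
  have ht : (Uᴴ * (Aᴴ * A * U)).trace = (Aᴴ * A).trace := by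
    rw [Matrix.trace_mul_comm Uᴴ (Aᴴ * A * U), mul_assoc (Aᴴ * A) U Uᴴ, ← Matrix.star_eq_conjTranspose U,
      Matrix.mem_unitaryGroup_iff.mp hU, mul_one]
  have h : ‖A * U‖ ^ 2 = ‖A‖ ^ 2 := by
    rw [frob_norm_sq_eq_re_trace, frob_norm_sq_eq_re_trace, Matrix.conjTranspose_mul,
      show Uᴴ * Aᴴ * (A * U) = Uᴴ * (Aᴴ * A * U) by simp only [mul_assoc], ht]
  exact (sq_eq_sq₀ (norm_nonneg _) (norm_nonneg _)).1 h

/-- `U^*` is unitary when `U` is (`G = U(N)` is a group under `*` with inverse `^*`). [cite: Federbush1987PhaseCellIII, §1 p. 294] -/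
theorem star_mem_unitaryGroup' {U : Matrix n n ℂ} (hU : U ∈ Matrix.unitaryGroup n ℂ) :
    star U ∈ Matrix.unitaryGroup n ℂ := by
  rw [Matrix.mem_unitaryGroup_iff, star_star]
  exact Matrix.mem_unitaryGroup_iff'.mp hU

/-- `‖U^* A U‖_F = ‖A‖_F` for unitary `U`: `Ad`-invariance of the inner product, i.e. bi-invariance of the metric of
`G = U(N)`. [cite: Federbush1987PhaseCellIII, §1 p. 294] [cite: LeeRiemannianManifolds2018, Prop. 3.12 / Problem 3-11] -/
theorem frob_norm_unitary_conj {U : Matrix n n ℂ} (hU : U ∈ Matrix.unitaryGroup n ℂ) (A : Matrix n n ℂ) :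
    ‖star U * A * U‖ = ‖A‖ := by
  rw [frob_norm_mul_unitary hU, frob_norm_unitary_mul (star_mem_unitaryGroup' hU)]

/-- Unitary conjugation passes through the series (21): `log(U^* X U) = U^* (log X) U` for `‖X − 1‖ < 1` — right
invariance `d(Ug, Vg) = d(U, V)` of the length metric of `G = U(N)` at the level of one step. [cite: Federbush1987PhaseCellIII, §1 p. 294] -/
theorem mlog_unitary_conj {U X : Matrix n n ℂ} (hU : U ∈ Matrix.unitaryGroup n ℂ) (hX : ‖X - 1‖ < 1) :
    mlog (star U * X * U) = star U * mlog X * U := by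
  have hUU : U * star U = 1 := Matrix.mem_unitaryGroup_iff.mp hU
  have hsub : star U * X * U - 1 = star U * (X - 1) * U := by
    rw [mul_sub, sub_mul, mul_one, Matrix.mem_unitaryGroup_iff'.mp hU]
  have hpow : ∀ k : ℕ, (star U * (X - 1) * U) ^ k = star U * (X - 1) ^ k * U := by
    intro k
    induction k with
    | zero => simp [Matrix.mem_unitaryGroup_iff'.mp hU]
    | succ k ih =>
      rw [pow_succ, ih, show star U * (X - 1) ^ k * U * (star U * (X - 1) * U)
          = star U * (X - 1) ^ k * (U * star U) * (X - 1) * U by simp only [mul_assoc], hUU, mul_one,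
        pow_succ, mul_assoc (star U) ((X - 1) ^ k)]
  have hX' : ‖star U * X * U - 1‖ < 1 := by rwa [hsub, frob_norm_unitary_conj hU]
  have h1 : HasSum (fun k : ℕ => logSeriesCoeff k • (star U * X * U - 1) ^ k) (star U * mlog X * U) := by
    refine (((hasSum_mlog hX).mul_left (star U)).mul_right U).congr_fun fun k => ?_
    show logSeriesCoeff k • (star U * X * U - 1) ^ k = star U * (logSeriesCoeff k • (X - 1) ^ k) * U
    rw [hsub, hpow, mul_smul_comm, smul_mul_assoc]
  exact (hasSum_mlog hX').unique h1

/-- For a unitary `W` near `1`, `log W` is skew: `(log W)^* = −log W`.  (`(log W)^* = log W^*` commutes with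
`log W`, `e^{log W^* + log W} = W^* W = 1`, and `exp` is injective near `0`.)  Along a fine chain in `U(N)` every
`log W_j` is therefore in the Lie algebra `𝔲(N)` (skew), as the discrete Gauss lemma requires. [cite: Federbush1987PhaseCellIII, Lemma 1.0 (1.3) p. 295] -/
theorem star_mlog_of_mem_unitaryGroup {W : Matrix n n ℂ} (hW : W ∈ Matrix.unitaryGroup n ℂ)
    (h : ‖W - 1‖ < 1 / 4) : star (mlog W) = -mlog W := by
  have hsW : ‖star W - 1‖ = ‖W - 1‖ := by rw [← star_one, ← star_sub, norm_star, star_one]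
  have hW1 : ‖W - 1‖ < 1 := by linarith
  have hW1' : ‖star W - 1‖ < 1 := by rw [hsW]; exact hW1
  have hcomm : Commute (mlog (star W)) (mlog W) := by
    have h1 : Commute (star W) W := by
      rw [Commute, SemiconjBy, Matrix.mem_unitaryGroup_iff'.mp hW, Matrix.mem_unitaryGroup_iff.mp hW]
    exact (commute_mlog_right (commute_mlog_right h1).symm).symm
  -- (`exp` lemmas are applied through `calc`/`congrArg₂`: the scoped Frobenius `NormedRing` and the bare
  -- `Matrix.instRing` give definitionally but not syntactically equal instance arguments of `exp`)
  have hexp : exp (mlog (star W) + mlog W) = 1 :=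
    calc exp (mlog (star W) + mlog W) = exp (mlog (star W)) * exp (mlog W) := exp_add_of_commute hcomm
      _ = star W * W := congrArg₂ (· * ·) (exp_mlog hW1') (exp_mlog hW1)
      _ = 1 := Matrix.mem_unitaryGroup_iff'.mp hW
  have hnorm : ‖mlog (star W) + mlog W‖ < 1 := by
    have h1 := norm_mlog_le_two_mul (show ‖W - 1‖ ≤ 1 / 2 by linarith)
    have h2 := norm_mlog_le_two_mul (show ‖star W - 1‖ ≤ 1 / 2 by linarith)
    calc ‖mlog (star W) + mlog W‖ ≤ ‖mlog (star W)‖ + ‖mlog W‖ := norm_add_le _ _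
      _ < 1 := by rw [hsW] at h2; linarith
  have h0 := eq_zero_of_exp_eq_one hnorm hexp
  rw [← mlog_star, ← sub_eq_zero, sub_neg_eq_add, h0]

/-- Chordal triangle inequality along the group: `‖a^*c − 1‖ ≤ ‖a^*b − 1‖ + ‖b^*c − 1‖` for unitary `a, b` — used for
`d(U, V) = 0 → U = V` of the length metric of `G = U(N)`. [cite: Federbush1987PhaseCellIII, §1 p. 294] -/
theorem norm_star_mul_sub_one_triangle {a b : Matrix n n ℂ} (ha : a ∈ Matrix.unitaryGroup n ℂ)
    (hb : b ∈ Matrix.unitaryGroup n ℂ) (c : Matrix n n ℂ) :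
    ‖star a * c - 1‖ ≤ ‖star a * b - 1‖ + ‖star b * c - 1‖ := by
  have hab : star a * b ∈ Matrix.unitaryGroup n ℂ := mul_mem (star_mem_unitaryGroup' ha) hb
  have e : star a * c - 1 = star a * b * (star b * c - 1) + (star a * b - 1) := by
    rw [mul_sub, mul_one, show star a * b * (star b * c) = star a * (b * star b) * c by simp only [mul_assoc],
      Matrix.mem_unitaryGroup_iff.mp hb, mul_one]
    abel
  rw [e]
  calc ‖star a * b * (star b * c - 1) + (star a * b - 1)‖
      ≤ ‖star a * b * (star b * c - 1)‖ + ‖star a * b - 1‖ := norm_add_le _ _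
    _ = ‖star a * b - 1‖ + ‖star b * c - 1‖ := by rw [frob_norm_unitary_mul hab, add_comm]

end Toolbox

end UNGauss

end Literature.MathematicalPhysics.QuantumFieldTheory.Federbush1986
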